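import Literature.NumberTheory.DiophantineGeometry.FunctionFieldHilbertRamification
import Literature.NumberTheory.DiophantineGeometry.FunctionFieldConstantExtensionSplittingProofs
import Mathlib.FieldTheory.Finite.Basic
import Mathlib.RingTheory.Frobenius
import HarnessLib

/-!
# Frobenius elements at unramified places of a Galois extension of function fields over a finite
field, and the count of places by Frobenius classes (Stichtenoth §3.7–3.8, Rosen Ch. 9)

Continuation of `FunctionFieldHilbertRamification` (the bridge places above `P` ↔ primes of the
integral closure `B` of `𝒪_P`, Mathlib's decomposition/inertia groups). For a finite Galois extension
`Ω/L` of function fields over a finite field `k` (group `Γ = Gal(Ω/L)`), a place `P` of `L` and a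
place `Q` of `Ω` above `P` (`𝔔 = Q ∩ B`):

* `exists_mul_eq_of_mem` (`𝒪_Q = B_𝔔`) and **`quotientEquivResidueField : B/𝔔 ≃+* κ(Q)`** (with the
  tree's `quotientToResidueField_injective/_surjective`), whence
  **`inertiaDeg_mul_degree_eq_mul_degree : f(𝔔|P) · deg P = R · deg Q`** (`#K' = #k^R` for the
  constant field `K'` of `Ω`), `inertiaDeg_mul_degree_eq_degree` (`f · deg P = deg Q` when
  `K' = k`), `degree_dvd_degree` — Stichtenoth Def. 3.1.5;
* the Frobenius element **`frob Q hQP ∈ Gal(Ω/L)`** (a chosen element of the decomposition group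
  inducing `x ↦ x^{#κ(P)}` on `B/𝔔 ≅ κ(Q)`; Mathlib's `arithFrobAt` for `𝔔 = Q ∩ B`,
  `isArithFrobAt_frob`): `comapRingEquiv_frob` (`Frob_Q(Q) = Q`),
  `valuation_frob_sub_pow_lt_one` (`Frob_Q y ≡ y^{#κ(P)} (mod Q)` on `𝒪_Q`), uniqueness at an
  unramified place `eq_frob_of_inertia_eq_bot` / `eq_frob_of_forall`, the criterion
  `inertia_eq_bot_of_forall`, the order **`orderOf_frob : orderOf Frob_Q = f(𝔔|P)`**,
  `frob_pow_eq_one_iff`, and functoriality **`restrictNormal_frob : Frob_Q|_M = Frob_{Q ∩ M}`** for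
  a Galois subextension `M` (Stichtenoth Def. 3.8.1, Thm. 3.8.2);
* **the count by Frobenius classes** (the bookkeeping behind Artin `L`-series / Chebotarev for
  function fields, Rosen Ch. 9; Stichtenoth Thm. 3.7.1, 3.8.3): `resDeg P Ω = f_P` (Mathlib
  `Ideal.inertiaDegIn`), `degree_eq_resDeg_mul_degree` (`deg Q = f_P deg P` for all `Q | P`),
  `natCard_placesOver_mul` (`#{Q | P} · |I| · f_P = |Γ|`), `sum_filter_degree_eq_of_unramified`
  (`∑_{Q | P, deg Q ∣ r} deg Q = |Γ| deg P · [f_P deg P ∣ r]` at an unramified `P`),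
  `sum_filter_degree_le` (`≤ |Γ| deg P` always), `pointCount_eq_sum_sum_filter` (`N_r(Ω)` fibrewise)
  and **`pointCount_eq_sum_unramified_add`**:
  `N_r(Ω) = ∑_{P ∉ U, f_P deg P ∣ r} |Γ| deg P + c`, `0 ≤ c ≤ |Γ| ∑_{P ∈ U} deg P`, for any finite
  `U` outside which `Ω/L` is unramified; `resDeg_mul_degree_dvd_iff`
  (`f_P deg P ∣ r ↔ deg P ∣ r ∧ Frob^{r/deg P} = 1`).

Everything is proved; no named facts; `frob`, `resDeg`, `quotientEquivResidueField` are genuine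
definitions. Intended use: the `L`-functions of the Lang–Artin–Schreier covering of an elliptic curve
(`Literature.NumberTheory.EllipticCurves.LangArtinSchreierCover`, towards
`KohelShparlinski.CoordinateCharSumBound`).

## References

* H. Stichtenoth, *Algebraic Function Fields and Codes*, 2nd ed., GTM 254, Springer 2009,
  Def. 3.1.3, Def. 3.1.5, Thm. 3.3.7, Lemma 3.5.2, Thm. 3.7.1, Def. 3.8.1, Thm. 3.8.2, Thm. 3.8.3,
  eq. (5.40). [Stichtenoth2009]
* M. Rosen, *Number Theory in Function Fields*, GTM 210, Springer 2002, Ch. 9 (Artin `L`-series and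
  the Chebotarev density theorem for function fields). [RosenFunctionFields2002]
-/

noncomputable section

open scoped Classical Pointwise

namespace Literature.NumberTheory.DiophantineGeometry.AlgFunctionField

universe u v w

open IsDedekindDomain

namespace PlaceOver

section ResidueField

variable {k : Type u} {L : Type v} [Field k] [Field L] [Algebra k L]
variable {Ω : Type w} [Field Ω] [Algebra L Ω]
variable {P : PlaceOver k L} [FiniteDimensional L Ω] [Algebra.IsSeparable L Ω]
variable {K' : Type*} [Field K'] [Finite K'] [Algebra K' Ω] [IsAlgFunctionField K' Ω]

/-- **`𝒪_Q = B_𝔔`**: every element of the valuation ring of `Q` is `b/s` with `b ∈ B` and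
`s ∈ B ∖ 𝔔` (`B` the integral closure of `𝒪_P`, `𝔔 = Q ∩ B`). [cite: Stichtenoth2009, Thm. 3.3.7 (proof)] -/
theorem exists_mul_eq_of_mem (Q : PlaceOver K' Ω)
    (hQP : ∀ x : L, algebraMap L Ω x ∈ Q.toValuationSubring ↔ x ∈ P.toValuationSubring)
    {y : Ω} (hy : y ∈ Q.toValuationSubring) :
    ∃ (b s : integralClosure P.toValuationSubring Ω), s ∉ primeBelow Q hQP ∧
      y * (s : Ω) = (b : Ω) := by
  set v : HeightOneSpectrum (integralClosure P.toValuationSubring Ω) :=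
    ⟨primeBelow Q hQP, inferInstance, primeBelow_ne_bot Q hQP⟩ with hv
  have hy' : v.valuation Ω y ≤ 1 := by
    rw [← mem_ofPrimeIntegralClosure_iff (K' := K') v y, hv, ofPrimeIntegralClosure_primeBelow Q hQP]
    exact hy
  obtain ⟨b, s, hbs⟩ := HeightOneSpectrum.exists_primeCompl_mul_eq_of_integer v y hy'
  exact ⟨b, s, s.2, hbs⟩

/-- **`B/𝔔 ≅ κ(Q)`**, the residue field of a place read on the integral closure of `𝒪_P`
(Stichtenoth Thm. 3.3.7 / Def. 3.1.5 setting). [cite: Stichtenoth2009, Thm. 3.3.7 (proof)] -/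
def quotientEquivResidueField (Q : PlaceOver K' Ω)
    (hQP : ∀ x : L, algebraMap L Ω x ∈ Q.toValuationSubring ↔ x ∈ P.toValuationSubring) :
    (integralClosure P.toValuationSubring Ω ⧸ primeBelow Q hQP) ≃+* Q.residueField :=
  RingEquiv.ofBijective (quotientToResidueField Q hQP)
    ⟨quotientToResidueField_injective Q hQP, quotientToResidueField_surjective Q hQP⟩

/-- Unfolding `quotientEquivResidueField` (definitional). [folklore] -/
@[simp]
theorem quotientEquivResidueField_apply (Q : PlaceOver K' Ω)
    (hQP : ∀ x : L, algebraMap L Ω x ∈ Q.toValuationSubring ↔ x ∈ P.toValuationSubring)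
    (a : integralClosure P.toValuationSubring Ω ⧸ primeBelow Q hQP) :
    quotientEquivResidueField Q hQP a = quotientToResidueField Q hQP a :=
  rfl

end ResidueField

section Degree

variable {k : Type u} {L : Type v} [Field k] [Finite k] [Field L] [Algebra k L] [IsAlgFunctionField k L]
variable {Ω : Type w} [Field Ω] [Algebra L Ω]
variable {P : PlaceOver k L} [FiniteDimensional L Ω] [Algebra.IsSeparable L Ω]
variable {K' : Type*} [Field K'] [Finite K'] [Algebra K' Ω] [IsAlgFunctionField K' Ω]

/-- **`f(𝔔|P) · deg P = R · deg Q`** for a place `Q` of `Ω/K'` above the place `P` of `L/k`, where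
`#K' = #k^R` (compare `#(B/𝔔) = #κ(P)^f = #k^{f deg P}` with `#κ(Q) = #K'^{deg Q} = #k^{R deg Q}`).
For `K' = k` (`R = 1`): `f · deg P = deg Q` (Stichtenoth Def. 3.1.5: `f(Q|P) = [κ(Q) : κ(P)]`).
[cite: Stichtenoth2009, Def. 3.1.5] -/
theorem inertiaDeg_mul_degree_eq_mul_degree (Q : PlaceOver K' Ω)
    (hQP : ∀ x : L, algebraMap L Ω x ∈ Q.toValuationSubring ↔ x ∈ P.toValuationSubring)
    {R : ℕ} (hK' : Nat.card K' = Nat.card k ^ R) :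
    (primeBelow Q hQP).inertiaDeg P.toValuationSubring * P.degree = R * Q.degree := by
  haveI := P.finite_residueField
  have h1 := (natCard_residueField_eq_natCard_quotient Q hQP).symm
  rw [natCard_quotient_primeBelow_eq_pow Q hQP, natCard_residueField P, natCard_residueField Q, hK',
    ← pow_mul, ← pow_mul] at h1
  have := Nat.pow_right_injective Finite.one_lt_card h1
  linarith [this]

/-- The case `K' = k`: **`f(𝔔|P) · deg P = deg Q`**. [cite: Stichtenoth2009, Def. 3.1.5] -/
theorem inertiaDeg_mul_degree_eq_degree [Algebra k Ω] [IsScalarTower k L Ω] [IsAlgFunctionField k Ω]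
    (Q : PlaceOver k Ω)
    (hQP : ∀ x : L, algebraMap L Ω x ∈ Q.toValuationSubring ↔ x ∈ P.toValuationSubring) :
    (primeBelow Q hQP).inertiaDeg P.toValuationSubring * P.degree = Q.degree := by
  have h := inertiaDeg_mul_degree_eq_mul_degree (k := k) (K' := k) Q hQP (R := 1) (pow_one _).symm
  rwa [one_mul] at h

/-- The degree of a place below divides the degree of a place above (`K' = k`). [cite: Stichtenoth2009, Def. 3.1.5] -/
theorem degree_dvd_degree [Algebra k Ω] [IsScalarTower k L Ω] [IsAlgFunctionField k Ω]
    (Q : PlaceOver k Ω)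
    (hQP : ∀ x : L, algebraMap L Ω x ∈ Q.toValuationSubring ↔ x ∈ P.toValuationSubring) :
    P.degree ∣ Q.degree :=
  ⟨(primeBelow Q hQP).inertiaDeg P.toValuationSubring, by
    rw [mul_comm]; exact (inertiaDeg_mul_degree_eq_degree Q hQP).symm⟩

end Degree

section Frobenius

variable {k : Type u} {L : Type v} [Field k] [Finite k] [Field L] [Algebra k L] [IsAlgFunctionField k L]
variable {Ω : Type w} [Field Ω] [Algebra L Ω]
variable {P : PlaceOver k L} [FiniteDimensional L Ω] [Algebra.IsSeparable L Ω] [IsGalois L Ω]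
variable {K' : Type*} [Field K'] [Finite K'] [Algebra K' Ω] [IsAlgFunctionField K' Ω]

omit [Finite k] [IsAlgFunctionField k L] [IsGalois L Ω] in
/-- `B/𝔔` is finite (it is the residue field of `Q`). [cite: Stichtenoth2009, Thm. 3.3.7 (proof)] -/
theorem finite_quotient_primeBelow (Q : PlaceOver K' Ω)
    (hQP : ∀ x : L, algebraMap L Ω x ∈ Q.toValuationSubring ↔ x ∈ P.toValuationSubring) :
    Finite (integralClosure P.toValuationSubring Ω ⧸ primeBelow Q hQP) := by
  haveI := Q.finite_residueField
  exact Finite.of_equiv _ (quotientEquivResidueField Q hQP).toEquiv.symm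

omit [Finite k] [IsAlgFunctionField k L] [Finite K'] [IsAlgFunctionField K' Ω] [FiniteDimensional L Ω]
  [Algebra.IsSeparable L Ω] [IsGalois L Ω] in
/-- `𝔔 ∩ 𝒪_P = 𝔪_P`. [folklore] -/
theorem under_primeBelow (Q : PlaceOver K' Ω)
    (hQP : ∀ x : L, algebraMap L Ω x ∈ Q.toValuationSubring ↔ x ∈ P.toValuationSubring) :
    (primeBelow Q hQP).under P.toValuationSubring = IsLocalRing.maximalIdeal P.toValuationSubring :=
  (Ideal.LiesOver.over (P := primeBelow Q hQP) (p := IsLocalRing.maximalIdeal P.toValuationSubring)).symm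

/-- **The Frobenius element `Frob_Q ∈ Gal(Ω/L)`** at a place `Q` of `Ω` above the place `P` of `L`:
Mathlib's `arithFrobAt` for the prime `𝔔 = Q ∩ B` of the integral closure `B` of `𝒪_P` — an element of
the decomposition group of `Q` inducing `x ↦ x^{#κ(P)}` on `B/𝔔 ≅ κ(Q)`, chosen compatibly under
conjugation; unique when `Q|P` is unramified (`eq_frob_of_inertia_eq_bot`).
[cite: Stichtenoth2009, Thm. 3.8.2] [cite: RosenFunctionFields2002, Ch. 9] -/
def frob (Q : PlaceOver K' Ω)
    (hQP : ∀ x : L, algebraMap L Ω x ∈ Q.toValuationSubring ↔ x ∈ P.toValuationSubring) : Ω ≃ₐ[L] Ω :=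
  haveI := finite_quotient_primeBelow Q hQP
  arithFrobAt P.toValuationSubring (Ω ≃ₐ[L] Ω) (primeBelow Q hQP)

omit [Finite k] [IsAlgFunctionField k L] in
/-- `Frob_Q` is an arithmetic Frobenius at `𝔔` (Mathlib `IsArithFrobAt`). [cite: Stichtenoth2009, Thm. 3.8.2] -/
theorem isArithFrobAt_frob (Q : PlaceOver K' Ω)
    (hQP : ∀ x : L, algebraMap L Ω x ∈ Q.toValuationSubring ↔ x ∈ P.toValuationSubring) :
    IsArithFrobAt P.toValuationSubring (frob Q hQP) (primeBelow Q hQP) := by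
  haveI := finite_quotient_primeBelow Q hQP
  exact IsArithFrobAt.arithFrobAt _ _ _

omit [Finite k] [IsAlgFunctionField k L] in
/-- `Frob_Q` stabilises `𝔔 = Q ∩ B`. [cite: Stichtenoth2009, Thm. 3.8.2] -/
theorem frob_smul_primeBelow (Q : PlaceOver K' Ω)
    (hQP : ∀ x : L, algebraMap L Ω x ∈ Q.toValuationSubring ↔ x ∈ P.toValuationSubring) :
    frob Q hQP • primeBelow Q hQP = primeBelow Q hQP :=
  MulAction.mem_stabilizer_iff.1 (isArithFrobAt_frob Q hQP).mem_stabilizer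

omit [Finite k] [IsAlgFunctionField k L] in
/-- `Frob_Q` acts as `b ↦ b^{#κ(P)}` modulo `𝔔` on `B`. [cite: Stichtenoth2009, Thm. 3.8.2] -/
theorem frob_smul_sub_pow_mem (Q : PlaceOver K' Ω)
    (hQP : ∀ x : L, algebraMap L Ω x ∈ Q.toValuationSubring ↔ x ∈ P.toValuationSubring)
    (b : integralClosure P.toValuationSubring Ω) :
    frob Q hQP • b - b ^ Nat.card P.residueField ∈ primeBelow Q hQP := by
  have h := isArithFrobAt_frob Q hQP b
  rwa [under_primeBelow Q hQP] at h

omit [Finite k] [IsAlgFunctionField k L] in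
/-- `Frob_Q (Q) = Q`. [cite: Stichtenoth2009, Thm. 3.8.2] -/
theorem comapRingEquiv_frob (Q : PlaceOver K' Ω)
    (hQP : ∀ x : L, algebraMap L Ω x ∈ Q.toValuationSubring ↔ x ∈ P.toValuationSubring) :
    Q.comapRingEquiv (frob Q hQP : Ω ≃+* Ω) = Q :=
  (smul_primeBelow_eq_iff _ Q hQP).1 (frob_smul_primeBelow Q hQP)

omit [Finite k] [IsAlgFunctionField k L] [FiniteDimensional L Ω] [Algebra.IsSeparable L Ω]
  [IsGalois L Ω] in
/-- An automorphism fixing the place `Q` preserves its valuation ring. [cite: Stichtenoth2009, Lemma 3.5.2] -/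
theorem apply_mem_of_comapRingEquiv_eq {θ : Ω ≃ₐ[L] Ω} {Q : PlaceOver K' Ω}
    (hθ : Q.comapRingEquiv (θ : Ω ≃+* Ω) = Q) {y : Ω} (hy : y ∈ Q.toValuationSubring) :
    θ y ∈ Q.toValuationSubring := by
  have : y ∈ (Q.comapRingEquiv (θ : Ω ≃+* Ω)).toValuationSubring := by rw [hθ]; exact hy
  exact (mem_comapRingEquiv_iff _ _ _).1 this

omit [Finite k] [IsAlgFunctionField k L] [FiniteDimensional L Ω] [Algebra.IsSeparable L Ω]
  [IsGalois L Ω] in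
/-- An automorphism fixing the place `Q` preserves its maximal ideal: `v_Q(θ y) < 1 ↔ v_Q(y) < 1`.
[cite: Stichtenoth2009, Lemma 3.5.2] -/
theorem valuation_apply_lt_one_iff {θ : Ω ≃ₐ[L] Ω} {Q : PlaceOver K' Ω}
    (hθ : Q.comapRingEquiv (θ : Ω ≃+* Ω) = Q) (y : Ω) :
    Q.valuation (θ y) < 1 ↔ Q.valuation y < 1 := by
  have h := valuation_comapRingEquiv_lt_one_iff (θ : Ω ≃+* Ω) Q y
  rw [hθ] at h
  exact h.symm

omit [Finite k] [IsAlgFunctionField k L] [IsGalois L Ω] in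
/-- The coset form on `B`: any `θ` with `θ • 𝔔 = 𝔔` and `θ b ≡ b^{#κ(P)} (mod 𝔔)` on `B` satisfies
the same congruence on all of `𝒪_Q = B_𝔔` (write `y = b/s`).
[cite: Stichtenoth2009, Thm. 3.8.2] -/
theorem valuation_apply_sub_pow_lt_one (Q : PlaceOver K' Ω)
    (hQP : ∀ x : L, algebraMap L Ω x ∈ Q.toValuationSubring ↔ x ∈ P.toValuationSubring)
    {θ : Ω ≃ₐ[L] Ω} (hθQ : θ • primeBelow Q hQP = primeBelow Q hQP)
    (hθ : ∀ b : integralClosure P.toValuationSubring Ω,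
      θ • b - b ^ Nat.card P.residueField ∈ primeBelow Q hQP)
    {y : Ω} (hy : y ∈ Q.toValuationSubring) :
    Q.valuation (θ y - y ^ Nat.card P.residueField) < 1 := by
  set N := Nat.card P.residueField with hN
  have hθQ' : Q.comapRingEquiv (θ : Ω ≃+* Ω) = Q := (smul_primeBelow_eq_iff _ Q hQP).1 hθQ
  obtain ⟨b, s, hs, hys⟩ := exists_mul_eq_of_mem Q hQP hy
  have hsv : Q.valuation (s : Ω) = 1 := valuation_eq_one_of_not_mem_primeBelow Q hQP hs
  have hs0 : ((s : integralClosure P.toValuationSubring Ω) : Ω) ≠ 0 := by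
    intro h; rw [h, Valuation.map_zero] at hsv; exact zero_ne_one hsv
  have hθsv : Q.valuation (θ (s : Ω)) = 1 := by
    -- `θ s ∉ m_Q` and `θ s ∈ O_Q`
    have h1 : Q.valuation (θ (s : Ω)) ≤ 1 :=
      (Q.toValuationSubring.valuation_le_one_iff _).2
        (apply_mem_of_comapRingEquiv_eq hθQ' (coe_mem_of_mem_integralClosure Q hQP s))
    have h2 : ¬ Q.valuation (θ (s : Ω)) < 1 := by
      rw [valuation_apply_lt_one_iff hθQ']
      exact fun h => (lt_irrefl _) (hsv ▸ h)
    exact le_antisymm h1 (not_lt.1 h2)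
  -- the congruences on `B` read in `Ω`
  have hb : Q.valuation (θ (b : Ω) - (b : Ω) ^ N) < 1 := by
    have := (mem_primeBelow_iff Q hQP _).1 (hθ b)
    simpa using this
  have hsc : Q.valuation (θ (s : Ω) - (s : Ω) ^ N) < 1 := by
    have := (mem_primeBelow_iff Q hQP _).1 (hθ s)
    simpa using this
  -- `y = b / s`: `(θ y - y^N) · θ s · s^N = (θ b - b^N) s^N - b^N (θ s - s^N)`
  have key : (θ y - y ^ N) * (θ (s : Ω) * (s : Ω) ^ N) =
      (θ (b : Ω) - (b : Ω) ^ N) * (s : Ω) ^ N - (b : Ω) ^ N * (θ (s : Ω) - (s : Ω) ^ N) := by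
    have hθb : θ (b : Ω) = θ y * θ (s : Ω) := by rw [← map_mul, hys]
    rw [hθb, ← hys]; ring
  have hv : Q.valuation ((θ y - y ^ N) * (θ (s : Ω) * (s : Ω) ^ N)) = Q.valuation (θ y - y ^ N) := by
    rw [Valuation.map_mul, Valuation.map_mul, Valuation.map_pow, hθsv, hsv, one_pow, mul_one, mul_one]
  rw [← hv, key]
  have hbv : Q.valuation (b : Ω) ≤ 1 :=
    (Q.toValuationSubring.valuation_le_one_iff _).2 (coe_mem_of_mem_integralClosure Q hQP b)
  refine lt_of_le_of_lt (Valuation.map_sub _ _ _) (max_lt ?_ ?_)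
  · rw [Valuation.map_mul, Valuation.map_pow, hsv, one_pow, mul_one]; exact hb
  · rw [Valuation.map_mul, Valuation.map_pow]
    calc Q.valuation (b : Ω) ^ N * Q.valuation (θ (s : Ω) - (s : Ω) ^ N)
        ≤ 1 * Q.valuation (θ (s : Ω) - (s : Ω) ^ N) := by
          gcongr; exact pow_le_one₀ zero_le hbv
      _ < 1 := by rw [one_mul]; exact hsc

omit [Finite k] [IsAlgFunctionField k L] in
/-- **`Frob_Q (y) ≡ y^{#κ(P)} (mod Q)` for all `y ∈ 𝒪_Q`.** [cite: Stichtenoth2009, Thm. 3.8.2] -/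
theorem valuation_frob_sub_pow_lt_one (Q : PlaceOver K' Ω)
    (hQP : ∀ x : L, algebraMap L Ω x ∈ Q.toValuationSubring ↔ x ∈ P.toValuationSubring)
    {y : Ω} (hy : y ∈ Q.toValuationSubring) :
    Q.valuation (frob Q hQP y - y ^ Nat.card P.residueField) < 1 :=
  valuation_apply_sub_pow_lt_one Q hQP (frob_smul_primeBelow Q hQP) (frob_smul_sub_pow_mem Q hQP) hy

omit [Finite k] [IsAlgFunctionField k L] in
/-- **Uniqueness of the Frobenius at an unramified place**: if the inertia group of `𝔔` is trivial,
any `θ` stabilising `𝔔` with `θ b ≡ b^{#κ(P)} (mod 𝔔)` on `B` is `Frob_Q` (`θ⁻¹ Frob_Q` lies in the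
inertia group). [cite: Stichtenoth2009, Thm. 3.8.2] -/
theorem eq_frob_of_inertia_eq_bot (Q : PlaceOver K' Ω)
    (hQP : ∀ x : L, algebraMap L Ω x ∈ Q.toValuationSubring ↔ x ∈ P.toValuationSubring)
    (hI : (primeBelow Q hQP).inertia (Ω ≃ₐ[L] Ω) = ⊥)
    {θ : Ω ≃ₐ[L] Ω} (hθQ : θ • primeBelow Q hQP = primeBelow Q hQP)
    (hθ : ∀ b : integralClosure P.toValuationSubring Ω,
      θ • b - b ^ Nat.card P.residueField ∈ primeBelow Q hQP) :
    θ = frob Q hQP := by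
  have hmem : θ⁻¹ * frob Q hQP ∈ (primeBelow Q hQP).inertia (Ω ≃ₐ[L] Ω) := by
    rw [Ideal.inertia, AddSubgroup.mem_inertia]
    intro b
    change (θ⁻¹ * frob Q hQP) • b - b ∈ primeBelow Q hQP
    have h1 : frob Q hQP • b - θ • b ∈ primeBelow Q hQP := by
      have := sub_mem (frob_smul_sub_pow_mem Q hQP b) (hθ b)
      rwa [sub_sub_sub_cancel_right] at this
    have h2 : θ⁻¹ • (frob Q hQP • b - θ • b) ∈ θ⁻¹ • primeBelow Q hQP :=
      Ideal.smul_mem_pointwise_smul _ _ _ h1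
    rw [smul_sub, smul_smul, smul_smul, inv_mul_cancel, one_smul] at h2
    have hθQ' : θ⁻¹ • primeBelow Q hQP = primeBelow Q hQP := by
      conv_lhs => rw [← hθQ]
      rw [smul_smul, inv_mul_cancel, one_smul]
    rwa [hθQ'] at h2
  rw [hI, Subgroup.mem_bot] at hmem
  rw [← mul_one θ, ← hmem, mul_inv_cancel_left]

omit [Finite k] [IsAlgFunctionField k L] in
/-- **Uniqueness, place-theoretic form**: at an unramified `Q`, an automorphism with `θ(Q) = Q` and
`θ y ≡ y^{#κ(P)} (mod Q)` for all `y ∈ 𝒪_Q` is `Frob_Q`. [cite: Stichtenoth2009, Thm. 3.8.2] -/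
theorem eq_frob_of_forall (Q : PlaceOver K' Ω)
    (hQP : ∀ x : L, algebraMap L Ω x ∈ Q.toValuationSubring ↔ x ∈ P.toValuationSubring)
    (hI : (primeBelow Q hQP).inertia (Ω ≃ₐ[L] Ω) = ⊥)
    {θ : Ω ≃ₐ[L] Ω} (hθQ : Q.comapRingEquiv (θ : Ω ≃+* Ω) = Q)
    (hθ : ∀ y ∈ Q.toValuationSubring, Q.valuation (θ y - y ^ Nat.card P.residueField) < 1) :
    θ = frob Q hQP := by
  refine eq_frob_of_inertia_eq_bot Q hQP hI ((smul_primeBelow_eq_iff _ Q hQP).2 hθQ) fun b => ?_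
  rw [mem_primeBelow_iff]
  have := hθ b (coe_mem_of_mem_integralClosure Q hQP b)
  simpa using this

omit [Finite k] [IsAlgFunctionField k L] [IsGalois L Ω] in
/-- **The inertia group is trivial iff no nontrivial automorphism fixing `Q` acts trivially on
`κ(Q)`** — the place-theoretic reading of `I(𝔔) = 1` used to verify unramifiedness in examples.
[cite: Stichtenoth2009, Def. 3.8.1 and Thm. 3.8.2] -/
theorem inertia_eq_bot_of_forall (Q : PlaceOver K' Ω)
    (hQP : ∀ x : L, algebraMap L Ω x ∈ Q.toValuationSubring ↔ x ∈ P.toValuationSubring)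
    (h : ∀ θ : Ω ≃ₐ[L] Ω, Q.comapRingEquiv (θ : Ω ≃+* Ω) = Q →
      (∀ y ∈ Q.toValuationSubring, Q.valuation (θ y - y) < 1) → θ = 1) :
    (primeBelow Q hQP).inertia (Ω ≃ₐ[L] Ω) = ⊥ := by
  rw [eq_bot_iff]
  intro θ hθ
  rw [Subgroup.mem_bot]
  have hθst : θ • primeBelow Q hQP = primeBelow Q hQP :=
    Ideal.inertia_le_stabilizer (primeBelow Q hQP) hθ
  have hθQ : Q.comapRingEquiv (θ : Ω ≃+* Ω) = Q := (smul_primeBelow_eq_iff _ Q hQP).1 hθst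
  refine h θ hθQ fun y hy => ?_
  rw [Ideal.inertia, AddSubgroup.mem_inertia] at hθ
  -- from `B` to `O_Q = B_𝔔`
  obtain ⟨b, s, hs, hys⟩ := exists_mul_eq_of_mem Q hQP hy
  have hsv : Q.valuation (s : Ω) = 1 := valuation_eq_one_of_not_mem_primeBelow Q hQP hs
  have hs0 : ((s : integralClosure P.toValuationSubring Ω) : Ω) ≠ 0 := by
    intro h0; rw [h0, Valuation.map_zero] at hsv; exact zero_ne_one hsv
  have hθsv : Q.valuation (θ (s : Ω)) = 1 := by
    have h1 : Q.valuation (θ (s : Ω)) ≤ 1 :=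
      (Q.toValuationSubring.valuation_le_one_iff _).2
        (apply_mem_of_comapRingEquiv_eq hθQ (coe_mem_of_mem_integralClosure Q hQP s))
    have h2 : ¬ Q.valuation (θ (s : Ω)) < 1 := by
      rw [valuation_apply_lt_one_iff hθQ]
      exact fun h' => (lt_irrefl _) (hsv ▸ h')
    exact le_antisymm h1 (not_lt.1 h2)
  have hb : Q.valuation (θ (b : Ω) - (b : Ω)) < 1 := by
    have := (mem_primeBelow_iff Q hQP _).1 (hθ b)
    simpa using this
  have hsc : Q.valuation (θ (s : Ω) - (s : Ω)) < 1 := by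
    have := (mem_primeBelow_iff Q hQP _).1 (hθ s)
    simpa using this
  have key : (θ y - y) * (θ (s : Ω) * (s : Ω)) =
      (θ (b : Ω) - (b : Ω)) * (s : Ω) - (b : Ω) * (θ (s : Ω) - (s : Ω)) := by
    have hθb : θ (b : Ω) = θ y * θ (s : Ω) := by rw [← map_mul, hys]
    rw [hθb, ← hys]; ring
  have hv : Q.valuation ((θ y - y) * (θ (s : Ω) * (s : Ω))) = Q.valuation (θ y - y) := by
    rw [Valuation.map_mul, Valuation.map_mul, hθsv, hsv, mul_one, mul_one]
  rw [← hv, key]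
  have hbv : Q.valuation (b : Ω) ≤ 1 :=
    (Q.toValuationSubring.valuation_le_one_iff _).2 (coe_mem_of_mem_integralClosure Q hQP b)
  refine lt_of_le_of_lt (Valuation.map_sub _ _ _) (max_lt ?_ ?_)
  · rw [Valuation.map_mul, hsv, mul_one]; exact hb
  · rw [Valuation.map_mul]
    calc Q.valuation (b : Ω) * Q.valuation (θ (s : Ω) - (s : Ω))
        ≤ 1 * Q.valuation (θ (s : Ω) - (s : Ω)) := by gcongr
      _ < 1 := by rw [one_mul]; exact hsc

/-- **The order of the Frobenius is the residue degree `f(𝔔|P)`** at an unramified place (the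
decomposition group maps isomorphically onto `Gal(κ(Q)/κ(P))`, generated by the Frobenius of order
`[κ(Q) : κ(P)]`). [cite: Stichtenoth2009, Thm. 3.8.2 and Thm. 3.8.3] -/
theorem orderOf_frob (Q : PlaceOver K' Ω)
    (hQP : ∀ x : L, algebraMap L Ω x ∈ Q.toValuationSubring ↔ x ∈ P.toValuationSubring)
    (hI : (primeBelow Q hQP).inertia (Ω ≃ₐ[L] Ω) = ⊥) :
    orderOf (frob Q hQP) = (primeBelow Q hQP).inertiaDeg P.toValuationSubring := by
  haveI := P.finite_residueField
  haveI : Finite (P.toValuationSubring ⧸ IsLocalRing.maximalIdeal P.toValuationSubring) :=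
    ‹Finite P.residueField›
  letI : Fintype (P.toValuationSubring ⧸ IsLocalRing.maximalIdeal P.toValuationSubring) :=
    Fintype.ofFinite _
  letI : Field (P.toValuationSubring ⧸ IsLocalRing.maximalIdeal P.toValuationSubring) :=
    Ideal.Quotient.field _
  haveI : (primeBelow Q hQP).IsMaximal := isMaximal_primeBelow Q hQP
  letI : Field (integralClosure P.toValuationSubring Ω ⧸ primeBelow Q hQP) :=
    Ideal.Quotient.field _
  haveI : Module.Finite (P.toValuationSubring ⧸ IsLocalRing.maximalIdeal P.toValuationSubring)
      (integralClosure P.toValuationSubring Ω ⧸ primeBelow Q hQP) := inferInstance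
  haveI : Algebra.IsAlgebraic (P.toValuationSubring ⧸ IsLocalRing.maximalIdeal P.toValuationSubring)
      (integralClosure P.toValuationSubring Ω ⧸ primeBelow Q hQP) := Algebra.IsAlgebraic.of_finite _ _
  haveI : Finite (integralClosure P.toValuationSubring Ω ⧸ primeBelow Q hQP) :=
    Module.finite_of_finite (P.toValuationSubring ⧸ IsLocalRing.maximalIdeal P.toValuationSubring)
  set φ := FiniteField.frobeniusAlgEquivOfAlgebraic
    (P.toValuationSubring ⧸ IsLocalRing.maximalIdeal P.toValuationSubring)
    (integralClosure P.toValuationSubring Ω ⧸ primeBelow Q hQP) with hφ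
  -- `Frob_Q` as an element of the decomposition group, mapping to `φ`
  have hθmem : frob Q hQP ∈ MulAction.stabilizer (Ω ≃ₐ[L] Ω) (primeBelow Q hQP) :=
    MulAction.mem_stabilizer_iff.2 (frob_smul_primeBelow Q hQP)
  have hθφ : Ideal.Quotient.stabilizerHom (primeBelow Q hQP)
      (IsLocalRing.maximalIdeal P.toValuationSubring) (Ω ≃ₐ[L] Ω) ⟨frob Q hQP, hθmem⟩ = φ := by
    apply AlgEquiv.ext
    intro x
    obtain ⟨b, rfl⟩ := Ideal.Quotient.mk_surjective x
    rw [Ideal.Quotient.stabilizerHom_apply, hφ, FiniteField.frobeniusAlgEquivOfAlgebraic_apply,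
      Fintype.card_eq_nat_card, ← map_pow, Ideal.Quotient.mk_eq_mk_iff_sub_mem]
    exact frob_smul_sub_pow_mem Q hQP b
  -- the kernel of `stabilizerHom` is the inertia group, trivial here
  have hinj : Function.Injective (Ideal.Quotient.stabilizerHom (primeBelow Q hQP)
      (IsLocalRing.maximalIdeal P.toValuationSubring) (Ω ≃ₐ[L] Ω)) := by
    rw [← MonoidHom.ker_eq_bot_iff, Ideal.Quotient.ker_stabilizerHom, Ideal.inertia,
      ← AddSubgroup.subgroupOf_inertia, eq_bot_iff]
    intro σ hσ
    rw [Subgroup.mem_subgroupOf] at hσ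
    change (σ : Ω ≃ₐ[L] Ω) ∈ (primeBelow Q hQP).inertia (Ω ≃ₐ[L] Ω) at hσ
    rw [hI, Subgroup.mem_bot] at hσ
    rw [Subgroup.mem_bot]
    exact Subtype.ext hσ
  have h1 : orderOf (⟨frob Q hQP, hθmem⟩ : MulAction.stabilizer (Ω ≃ₐ[L] Ω) (primeBelow Q hQP)) =
      orderOf φ := by rw [← hθφ, orderOf_injective _ hinj]
  rw [Ideal.inertiaDeg_eq_of_isMaximal (IsLocalRing.maximalIdeal P.toValuationSubring),
    ← FiniteField.orderOf_frobeniusAlgEquivOfAlgebraic, ← hφ, ← h1]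
  exact Subgroup.orderOf_coe
    (⟨frob Q hQP, hθmem⟩ : MulAction.stabilizer (Ω ≃ₐ[L] Ω) (primeBelow Q hQP))

/-- `Frob_Q ^ m = 1 ↔ f(𝔔|P) ∣ m` at an unramified place. [cite: Stichtenoth2009, Thm. 3.8.3] -/
theorem frob_pow_eq_one_iff (Q : PlaceOver K' Ω)
    (hQP : ∀ x : L, algebraMap L Ω x ∈ Q.toValuationSubring ↔ x ∈ P.toValuationSubring)
    (hI : (primeBelow Q hQP).inertia (Ω ≃ₐ[L] Ω) = ⊥) (m : ℕ) :
    frob Q hQP ^ m = 1 ↔ (primeBelow Q hQP).inertiaDeg P.toValuationSubring ∣ m := by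
  rw [← orderOf_frob Q hQP hI, orderOf_dvd_iff_pow_eq_one]

end Frobenius

section Restriction

variable {k : Type u} {L : Type v} [Field k] [Finite k] [Field L] [Algebra k L] [IsAlgFunctionField k L]
variable {M : Type w} [Field M] [Algebra L M] [Algebra k M] [IsScalarTower k L M]
  [FiniteDimensional L M] [IsGalois L M] [IsAlgFunctionField k M]
variable {Ω : Type w} [Field Ω] [Algebra L Ω] [Algebra M Ω] [IsScalarTower L M Ω]
  [Algebra k Ω] [IsScalarTower k L Ω] [IsScalarTower k M Ω]
  [FiniteDimensional L Ω] [FiniteDimensional M Ω] [Algebra.IsSeparable L Ω] [IsGalois L Ω]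
  [IsAlgFunctionField k Ω]
variable {P : PlaceOver k L}

omit [Finite k] [IsAlgFunctionField k L] [IsGalois L M] [Algebra L Ω] [IsScalarTower L M Ω] [IsScalarTower k L Ω]
  [FiniteDimensional L Ω] [Algebra.IsSeparable L Ω] [IsGalois L Ω] [Algebra L M] [IsScalarTower k L M]
  [FiniteDimensional L M] in
omit [IsAlgFunctionField k Ω] in
/-- `v_{Q ∩ M}(z) < 1 ↔ v_Q(z) < 1` for `z ∈ M`. [cite: Stichtenoth2009, Def. 3.1.3] -/
theorem valuation_restrict_lt_one_iff (Q : PlaceOver k Ω) (z : M) :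
    (Q.restrict (K := k) (F := M)).valuation z < 1 ↔ Q.valuation (algebraMap M Ω z) < 1 := by
  by_cases hz : z = 0
  · simp [hz]
  rw [valuation_lt_one_iff_inv_notMem (Q.restrict (K := k) (F := M)).toValuationSubring hz,
    valuation_lt_one_iff_inv_notMem Q.toValuationSubring ((_root_.map_ne_zero _).mpr hz),
    mem_restrict_iff, map_inv₀]

omit [Finite k] [IsAlgFunctionField k L] [IsGalois L M] [IsScalarTower k L Ω] [FiniteDimensional L Ω]
  [Algebra.IsSeparable L Ω] [IsGalois L Ω] [IsScalarTower k L M] [FiniteDimensional L M] in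
omit [IsAlgFunctionField k Ω] in
/-- A place of `Ω` above `P` restricts to a place of `M` above `P`. [cite: Stichtenoth2009, Def. 3.1.3] -/
theorem forall_mem_restrict_iff (Q : PlaceOver k Ω)
    (hQP : ∀ x : L, algebraMap L Ω x ∈ Q.toValuationSubring ↔ x ∈ P.toValuationSubring) (x : L) :
    algebraMap L M x ∈ (Q.restrict (K := k) (F := M)).toValuationSubring ↔ x ∈ P.toValuationSubring := by
  rw [mem_restrict_iff, ← IsScalarTower.algebraMap_apply, hQP]

omit [IsScalarTower k L M] [IsScalarTower k L Ω] [IsAlgFunctionField k L] in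
/-- **Frobenius elements restrict to Frobenius elements**: for a Galois subextension `M/L` of
`Ω/L` and `Q` unramified above `P` together with its restriction `Q ∩ M`,
`Frob_Q|_M = Frob_{Q ∩ M}`. [cite: Stichtenoth2009, Thm. 3.8.2] [cite: RosenFunctionFields2002, Ch. 9] -/
theorem restrictNormal_frob (Q : PlaceOver k Ω)
    (hQP : ∀ x : L, algebraMap L Ω x ∈ Q.toValuationSubring ↔ x ∈ P.toValuationSubring)
    (hIM : (primeBelow (Q.restrict (K := k) (F := M)) (forall_mem_restrict_iff Q hQP)).inertia
      (M ≃ₐ[L] M) = ⊥) :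
    (frob Q hQP).restrictNormal M = frob (Q.restrict (K := k) (F := M)) (forall_mem_restrict_iff Q hQP) := by
  set θ := frob Q hQP with hθ
  have hθQ : Q.comapRingEquiv (θ : Ω ≃+* Ω) = Q := comapRingEquiv_frob Q hQP
  have hiff : ∀ w : Ω, θ w ∈ Q.toValuationSubring ↔ w ∈ Q.toValuationSubring := fun w => by
    have h := mem_comapRingEquiv_iff (θ : Ω ≃+* Ω) Q w
    rw [hθQ] at h
    exact h.symm
  refine eq_frob_of_forall _ _ hIM ?_ ?_
  · apply PlaceOver.ext
    ext z
    rw [mem_comapRingEquiv_iff, mem_restrict_iff, mem_restrict_iff]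
    change algebraMap M Ω ((θ.restrictNormal M) z) ∈ _ ↔ _
    rw [AlgEquiv.restrictNormal_commutes]
    exact hiff _
  · intro y hy
    rw [valuation_restrict_lt_one_iff, map_sub, map_pow]
    change Q.valuation (algebraMap M Ω ((θ.restrictNormal M) y) - _) < 1
    rw [AlgEquiv.restrictNormal_commutes]
    exact valuation_frob_sub_pow_lt_one Q hQP ((mem_restrict_iff _ _).1 hy)

end Restriction

section Count

variable {k : Type u} {L : Type v} [Field k] [Finite k] [Field L] [Algebra k L] [IsAlgFunctionField k L]
variable {Ω : Type w} [Field Ω] [Algebra L Ω] [Algebra k Ω] [IsScalarTower k L Ω]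
  [FiniteDimensional L Ω] [Algebra.IsSeparable L Ω] [IsGalois L Ω] [IsAlgFunctionField k Ω]

/-- The places of `Ω` above a place `P` of `L` form a finite set (as many as the primes of `B`
above `P`). [cite: Stichtenoth2009, Cor. 3.1.8 / Thm. 3.3.7] -/
instance finite_placesOver (P : PlaceOver k L) :
    Finite {Q : PlaceOver k Ω // Q.restrict (K := k) (F := L) = P} := by
  haveI : Finite ((IsLocalRing.maximalIdeal P.toValuationSubring).primesOver
      (integralClosure P.toValuationSubring Ω)) :=
    (IsDedekindDomain.primesOver_finite _ _).to_subtype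
  exact Finite.of_equiv _ ((Equiv.subtypeEquivRight fun Q => restrict_eq_iff Q P).trans
    (placesOverEquiv (K' := k) P)).symm

/-- **The residue degree `f_P` of `P` in the Galois extension `Ω/L`** (the common residue degree
`f(𝔔|P)` of the primes above `P`, Mathlib `Ideal.inertiaDegIn`). [cite: Stichtenoth2009, Def. 3.1.5 and Thm. 3.7.1] -/
abbrev resDeg (P : PlaceOver k L) (Ω : Type w) [Field Ω] [Algebra L Ω] : ℕ :=
  (IsLocalRing.maximalIdeal P.toValuationSubring).inertiaDegIn (integralClosure P.toValuationSubring Ω)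

omit [Finite k] [IsAlgFunctionField k L] [IsScalarTower k L Ω] [Algebra.IsSeparable L Ω] [IsAlgFunctionField k Ω] in
/-- In a Galois extension all residue degrees above `P` equal `f_P`. [cite: Stichtenoth2009, Thm. 3.7.1] -/
theorem inertiaDeg_primeBelow_eq_resDeg {P : PlaceOver k L} (Q : PlaceOver k Ω)
    (hQP : ∀ x : L, algebraMap L Ω x ∈ Q.toValuationSubring ↔ x ∈ P.toValuationSubring) :
    (primeBelow Q hQP).inertiaDeg P.toValuationSubring = P.resDeg Ω :=
  (Ideal.inertiaDegIn_eq_inertiaDeg (IsLocalRing.maximalIdeal P.toValuationSubring)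
    (primeBelow Q hQP) (Ω ≃ₐ[L] Ω)).symm

/-- **`deg Q = f_P · deg P` for every place `Q` above `P`** in the Galois extension `Ω/L` (both with
constant field `k`). [cite: Stichtenoth2009, Def. 3.1.5 and Thm. 3.7.1] -/
theorem degree_eq_resDeg_mul_degree {P : PlaceOver k L} (Q : PlaceOver k Ω)
    (hQ : Q.restrict (K := k) (F := L) = P) : Q.degree = P.resDeg Ω * P.degree := by
  have hQP := (restrict_eq_iff Q P).1 hQ
  rw [← inertiaDeg_primeBelow_eq_resDeg Q hQP, inertiaDeg_mul_degree_eq_degree Q hQP]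

omit [Algebra.IsSeparable L Ω] in
/-- **`#{Q | P} · |I| · f_P = |Γ|`.** [cite: Stichtenoth2009, Thm. 3.7.1 and Thm. 3.8.2] -/
theorem natCard_placesOver_mul (P : PlaceOver k L) (Q : PlaceOver k Ω)
    (hQP : ∀ x : L, algebraMap L Ω x ∈ Q.toValuationSubring ↔ x ∈ P.toValuationSubring) :
    Nat.card {Q : PlaceOver k Ω // Q.restrict (K := k) (F := L) = P} *
      Nat.card ((primeBelow Q hQP).inertia (Ω ≃ₐ[L] Ω)) * P.resDeg Ω = Nat.card (Ω ≃ₐ[L] Ω) := by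
  haveI := P.finite_residueField
  haveI : Finite (P.toValuationSubring ⧸ IsLocalRing.maximalIdeal P.toValuationSubring) :=
    ‹Finite P.residueField›
  letI : Field (P.toValuationSubring ⧸ IsLocalRing.maximalIdeal P.toValuationSubring) :=
    Ideal.Quotient.field _
  haveI : Finite (IsLocalRing.maximalIdeal P.toValuationSubring).ResidueField := inferInstance
  haveI : PerfectField (IsLocalRing.maximalIdeal P.toValuationSubring).ResidueField := inferInstance
  rw [natCard_restrict_eq (K' := k) P, ← inertiaDeg_primeBelow_eq_resDeg Q hQP]
  exact Ideal.ncard_primesOver_mul_card_inertia_mul_finrank (G := Ω ≃ₐ[L] Ω)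
    (IsLocalRing.maximalIdeal P.toValuationSubring) (primeBelow Q hQP)

/-- **The count at an unramified place**: if the inertia group above `P` is trivial, then
`∑_{Q | P, deg Q ∣ r} deg Q = |Γ| · deg P` when `f_P · deg P ∣ r` and `= 0` otherwise
(all `Q | P` have degree `f_P deg P`, and there are `|Γ|/f_P` of them). The sum runs over the
places above `P` inside any finite set `T` containing all places of degree `≤ r`.
[cite: Stichtenoth2009, Thm. 3.7.1 and Thm. 3.8.3] [cite: RosenFunctionFields2002, Ch. 9] -/
theorem sum_filter_degree_eq_of_unramified {r : ℕ} (hr : 0 < r) (T : Finset (PlaceOver k Ω))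
    (hT : ∀ Q : PlaceOver k Ω, Q.degree ≤ r → Q ∈ T) (P : PlaceOver k L) (Q₀ : PlaceOver k Ω)
    (hQ₀P : ∀ x : L, algebraMap L Ω x ∈ Q₀.toValuationSubring ↔ x ∈ P.toValuationSubring)
    (hI : (primeBelow Q₀ hQ₀P).inertia (Ω ≃ₐ[L] Ω) = ⊥) :
    ∑ Q ∈ T.filter (fun Q => Q.restrict (K := k) (F := L) = P),
        (if Q.degree ∣ r then Q.degree else 0) =
      if P.resDeg Ω * P.degree ∣ r then Nat.card (Ω ≃ₐ[L] Ω) * P.degree else 0 := by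
  have hdeg : ∀ Q : PlaceOver k Ω, Q.restrict (K := k) (F := L) = P →
      Q.degree = P.resDeg Ω * P.degree := fun Q hQ => degree_eq_resDeg_mul_degree Q hQ
  have hcard := natCard_placesOver_mul P Q₀ hQ₀P
  rw [hI, Subgroup.card_bot, mul_one] at hcard
  by_cases hdvd : P.resDeg Ω * P.degree ∣ r
  · rw [if_pos hdvd]
    -- every place above `P` has degree `f d ∣ r`, hence lies in `T`
    have hmem : ∀ Q : PlaceOver k Ω, Q ∈ T.filter (fun Q => Q.restrict (K := k) (F := L) = P) ↔
        Q.restrict (K := k) (F := L) = P := by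
      intro Q
      rw [Finset.mem_filter]
      refine ⟨fun h => h.2, fun h => ⟨hT Q ?_, h⟩⟩
      rw [hdeg Q h]
      exact Nat.le_of_dvd hr hdvd
    have hsum : ∑ Q ∈ T.filter (fun Q => Q.restrict (K := k) (F := L) = P),
        (if Q.degree ∣ r then Q.degree else 0) =
        ∑ Q ∈ T.filter (fun Q => Q.restrict (K := k) (F := L) = P), P.resDeg Ω * P.degree := by
      refine Finset.sum_congr rfl fun Q hQ => ?_
      rw [hdeg Q ((hmem Q).1 hQ), if_pos hdvd]
    have hcardT : (T.filter (fun Q => Q.restrict (K := k) (F := L) = P)).card =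
        Nat.card {Q : PlaceOver k Ω // Q.restrict (K := k) (F := L) = P} := by
      rw [← Fintype.card_coe, ← Nat.card_eq_fintype_card]
      exact Nat.card_congr (Equiv.subtypeEquivRight fun Q => hmem Q)
    rw [hsum, Finset.sum_const, smul_eq_mul, hcardT, ← hcard]
    ring
  · rw [if_neg hdvd]
    refine Finset.sum_eq_zero fun Q hQ => ?_
    rw [hdeg Q (Finset.mem_filter.1 hQ).2, if_neg hdvd]

/-- **The crude count at an arbitrary place**: `∑_{Q | P, deg Q ∣ r} deg Q ≤ |Γ| · deg P`
(`#{Q | P} · f_P ≤ #{Q | P} · e · f_P = |Γ|`). [cite: Stichtenoth2009, Thm. 3.7.1] -/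
theorem sum_filter_degree_le (r : ℕ) (T : Finset (PlaceOver k Ω)) (P : PlaceOver k L) :
    ∑ Q ∈ T.filter (fun Q => Q.restrict (K := k) (F := L) = P),
        (if Q.degree ∣ r then Q.degree else 0) ≤ Nat.card (Ω ≃ₐ[L] Ω) * P.degree := by
  obtain ⟨Q₀, hQ₀⟩ := exists_restrict_eq (K' := k) (F' := Ω) P
  have hQ₀P := (restrict_eq_iff Q₀ P).1 hQ₀
  have hcard := natCard_placesOver_mul P Q₀ hQ₀P
  have hdeg : ∀ Q : PlaceOver k Ω, Q.restrict (K := k) (F := L) = P →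
      Q.degree = P.resDeg Ω * P.degree := fun Q hQ => degree_eq_resDeg_mul_degree Q hQ
  have hIpos : 1 ≤ Nat.card ((primeBelow Q₀ hQ₀P).inertia (Ω ≃ₐ[L] Ω)) := Nat.card_pos
  have hcardT : (T.filter (fun Q => Q.restrict (K := k) (F := L) = P)).card ≤
      Nat.card {Q : PlaceOver k Ω // Q.restrict (K := k) (F := L) = P} := by
    rw [← Fintype.card_coe, ← Nat.card_eq_fintype_card]
    refine Nat.card_le_card_of_injective
      (fun Q => (⟨Q.1, (Finset.mem_filter.1 Q.2).2⟩ :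
        {Q : PlaceOver k Ω // Q.restrict (K := k) (F := L) = P})) fun a b h => ?_
    have h' := congrArg Subtype.val h
    exact Subtype.ext h' 
  calc ∑ Q ∈ T.filter (fun Q => Q.restrict (K := k) (F := L) = P),
        (if Q.degree ∣ r then Q.degree else 0)
      ≤ ∑ Q ∈ T.filter (fun Q => Q.restrict (K := k) (F := L) = P), P.resDeg Ω * P.degree := by
        refine Finset.sum_le_sum fun Q hQ => ?_
        rw [← hdeg Q (Finset.mem_filter.1 hQ).2]
        split_ifs <;> simp
    _ = (T.filter (fun Q => Q.restrict (K := k) (F := L) = P)).card * (P.resDeg Ω * P.degree) := by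
        rw [Finset.sum_const, smul_eq_mul]
    _ ≤ Nat.card {Q : PlaceOver k Ω // Q.restrict (K := k) (F := L) = P} *
          Nat.card ((primeBelow Q₀ hQ₀P).inertia (Ω ≃ₐ[L] Ω)) * (P.resDeg Ω * P.degree) := by
        have : (T.filter (fun Q => Q.restrict (K := k) (F := L) = P)).card ≤
            Nat.card {Q : PlaceOver k Ω // Q.restrict (K := k) (F := L) = P} *
              Nat.card ((primeBelow Q₀ hQ₀P).inertia (Ω ≃ₐ[L] Ω)) :=
          hcardT.trans (Nat.le_mul_of_pos_right _ hIpos)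
        exact Nat.mul_le_mul_right _ this
    _ = Nat.card (Ω ≃ₐ[L] Ω) * P.degree := by rw [← hcard]; ring

omit [IsGalois L Ω] in
/-- **`N_r(Ω)` fibrewise**: `∑_{deg Q ∣ r} deg Q = ∑_P ∑_{Q | P, deg Q ∣ r} deg Q`, the outer sum over
any finite set `S` of places of `L` containing those of degree `≤ r`, the inner over the places of
`Ω` of degree `≤ r`. [cite: Stichtenoth2009, eq. (5.40) and Def. 3.1.3] -/
theorem pointCount_eq_sum_sum_filter {r : ℕ} (hr : 0 < r) (S : Finset (PlaceOver k L))
    (hS : ∀ P : PlaceOver k L, P.degree ≤ r → P ∈ S) :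
    pointCount k Ω r = ∑ P ∈ S,
      ∑ Q ∈ (finite_setOf_degree_le (K := k) (F := Ω) r).toFinset.filter
          (fun Q => Q.restrict (K := k) (F := L) = P),
        (if Q.degree ∣ r then Q.degree else 0) := by
  set T := (finite_setOf_degree_le (K := k) (F := Ω) r).toFinset with hT
  have hTmem : ∀ Q : PlaceOver k Ω, Q ∈ T ↔ Q.degree ≤ r := fun Q => by
    rw [hT, Set.Finite.mem_toFinset]; rfl
  rw [pointCount_eq_sum_ite_dvd hr.ne' le_rfl T fun Q hQ => (hTmem Q).2 hQ]
  symm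
  refine Finset.sum_fiberwise_of_maps_to (g := fun Q : PlaceOver k Ω => Q.restrict (K := k) (F := L))
    (fun Q hQ => hS _ ?_) (fun Q : PlaceOver k Ω => if Q.degree ∣ r then Q.degree else 0)
  have hd := degree_dvd_degree (P := Q.restrict (K := k) (F := L)) Q ((restrict_eq_iff Q _).1 rfl)
  exact (Nat.le_of_dvd (one_le_degree Q) hd).trans ((hTmem Q).1 hQ)

/-- **The count of `N_r(Ω)` by the places below** (the bookkeeping behind Artin `L`-series /
Chebotarev for function fields, Rosen Ch. 9; Stichtenoth Thm. 3.8.3): if `Ω/L` is unramified at the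
places of `S ∖ U` (all places of `L` of degree `≤ r` lying in `S`), then
`N_r(Ω) = ∑_{P ∈ S ∖ U, f_P deg P ∣ r} |Γ| deg P + c` with `0 ≤ c ≤ |Γ| · ∑_{P ∈ U} deg P`.
[cite: RosenFunctionFields2002, Ch. 9] [cite: Stichtenoth2009, Thm. 3.8.3] -/
theorem pointCount_eq_sum_unramified_add {r : ℕ} (hr : 0 < r) (S U : Finset (PlaceOver k L))
    (hS : ∀ P : PlaceOver k L, P.degree ≤ r → P ∈ S)
    (hunr : ∀ P ∈ S, P ∉ U → ∀ (Q : PlaceOver k Ω)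
      (hQP : ∀ x : L, algebraMap L Ω x ∈ Q.toValuationSubring ↔ x ∈ P.toValuationSubring),
      (primeBelow Q hQP).inertia (Ω ≃ₐ[L] Ω) = ⊥) :
    ∃ c : ℕ, c ≤ Nat.card (Ω ≃ₐ[L] Ω) * ∑ P ∈ U, P.degree ∧
      pointCount k Ω r =
        ∑ P ∈ S \ U, (if P.resDeg Ω * P.degree ∣ r then Nat.card (Ω ≃ₐ[L] Ω) * P.degree else 0) + c := by
  set T := (finite_setOf_degree_le (K := k) (F := Ω) r).toFinset with hT
  have hTmem : ∀ Q : PlaceOver k Ω, Q.degree ≤ r → Q ∈ T := fun Q hQ => by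
    rw [hT, Set.Finite.mem_toFinset]; exact hQ
  refine ⟨∑ P ∈ S ∩ U, ∑ Q ∈ T.filter (fun Q => Q.restrict (K := k) (F := L) = P),
    (if Q.degree ∣ r then Q.degree else 0), ?_, ?_⟩
  · calc ∑ P ∈ S ∩ U, ∑ Q ∈ T.filter (fun Q => Q.restrict (K := k) (F := L) = P),
            (if Q.degree ∣ r then Q.degree else 0)
          ≤ ∑ P ∈ S ∩ U, Nat.card (Ω ≃ₐ[L] Ω) * P.degree :=
          Finset.sum_le_sum fun P _ => sum_filter_degree_le r T P
      _ ≤ ∑ P ∈ U, Nat.card (Ω ≃ₐ[L] Ω) * P.degree :=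
          Finset.sum_le_sum_of_subset_of_nonneg Finset.inter_subset_right fun _ _ _ => Nat.zero_le _
      _ = Nat.card (Ω ≃ₐ[L] Ω) * ∑ P ∈ U, P.degree := by rw [Finset.mul_sum]
  · rw [pointCount_eq_sum_sum_filter (Ω := Ω) hr S hS, ← hT,
      ← Finset.sum_sdiff (Finset.inter_subset_left (s₁ := S) (s₂ := U)), Finset.sdiff_inter_self_left]
    congr 1
    refine Finset.sum_congr rfl fun P hP => ?_
    obtain ⟨hPS, hPU⟩ := Finset.mem_sdiff.1 hP
    obtain ⟨Q₀, hQ₀⟩ := exists_restrict_eq (K' := k) (F' := Ω) P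
    have hQ₀P := (restrict_eq_iff Q₀ P).1 hQ₀
    exact sum_filter_degree_eq_of_unramified hr T (fun Q hQ => hTmem Q hQ) P Q₀ hQ₀P
      (hunr P hPS hPU Q₀ hQ₀P)

omit [IsScalarTower k L Ω] in
/-- `f_P · deg P ∣ r ↔ deg P ∣ r ∧ Frob_Q^{r / deg P} = 1` (unramified `Q | P`): the Frobenius form of
the divisibility condition in the count. [cite: Stichtenoth2009, Thm. 3.8.3] -/
theorem resDeg_mul_degree_dvd_iff {r : ℕ} {P : PlaceOver k L} (Q : PlaceOver k Ω)
    (hQP : ∀ x : L, algebraMap L Ω x ∈ Q.toValuationSubring ↔ x ∈ P.toValuationSubring)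
    (hI : (primeBelow Q hQP).inertia (Ω ≃ₐ[L] Ω) = ⊥) :
    P.resDeg Ω * P.degree ∣ r ↔ P.degree ∣ r ∧ frob Q hQP ^ (r / P.degree) = 1 := by
  rw [frob_pow_eq_one_iff Q hQP hI, inertiaDeg_primeBelow_eq_resDeg Q hQP]
  have hd : 0 < P.degree := one_le_degree P
  constructor
  · rintro ⟨m, hm⟩
    refine ⟨⟨P.resDeg Ω * m, by rw [hm]; ring⟩, ⟨m, ?_⟩⟩
    rw [hm, mul_comm (P.resDeg Ω) P.degree, mul_assoc, Nat.mul_div_cancel_left _ hd]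
  · rintro ⟨⟨a, ha⟩, ⟨m, hm⟩⟩
    rw [ha, Nat.mul_div_cancel_left _ hd] at hm
    exact ⟨m, by rw [ha, hm]; ring⟩

end Count



end PlaceOver

end Literature.NumberTheory.DiophantineGeometry.AlgFunctionField
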